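import Summits.QuantumFields.BalabanUV.T4Continuum.Support.ShellMeasureLandauPinnedKernels

/-!
# `T4Continuum.ShellMeasurePinnedDressOneTuple` — «THE 𝓔-LEG's SCHEME TUPLE IS THE w-TUPLE IN S69's PINNED DRESS», file 1:
# the three junction shapes — linear letters `kerOpPin` of displayed decay kernels (S69 (A) in binder form), the (P4)
# letter `Prop4Hyp` between the pinned spaces BY LOCALITY from the flat `Prop4Hyp`, the coarse datum read through the pin
(cell `pub-balaban`, sub-cell `t4`, spine estimate NE7c (node U5b); NE7c ROUND-2 crew `t4-ne7c-formalise-*`, unit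
`b2b-balaban-t4-ne7c-formalise-leaf-01` gen 11; owner table `t4/b2b-balaban-t4-ne7c-p1/LEAVES-NE7c-P1.md` **ROW S113** «THE 𝓔-LEG READS THE
w-TUPLE's PINNED DRESS» (own-initiative OFFER O-ne7cleaf01g11-1, journal l.22130; ACCEPTED as the designed reading and BOOKED by the
owner, R-ne7cp1-g37-1 (c1), l.22905 — file 1 of the row; file 2 `ShellMeasureRayTermsPinnedLandauW` fires S71 f2 with it); ADDITIVE — imports S81 f2 `ShellMeasureLandauPinnedKernels` (p227859, leaf-07-g7;
hence S81 f1, S75 `ShellMeasurePinnedProp4`, S69 `ShellMeasurePinnedNorm`, S65 f2a `ShellMeasureMultiGridNorms`) ONLY; [folklore];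
0 `def`, 0 `def … : Prop`, 0 sorry, 0 citation)

HONEST FRAMING.  Finite four-torus programme, rung (B)+1 only — NOT infinite volume, NOT a mass gap, NOT the Clay problem, NOT
summit progress; (B), `BetaPertHyp`, (B^μ) not consumed.  NE7c (`T4IndicatorShell.ShellWeightBound` for the cell's expansions) is
NOT PRINTED in [Balaban 1983–89] and NOT PROVED; «NE7c ⇐ the named binders» (trigger c3).  PLUMBING ON OUR SIDE: functional
analysis on finite index sets; nothing of Bałaban's is asserted, cited or discharged.  HONEST DEPENDENCY (cell): continuum YM on
T⁴ ⇐ BetaPertH ∧ nine spine estimates (0/9 proved); BetaPertH ⇐ (D1) ∧ (D4) ∧ CAP+tail; G-an2-4 gates asym, D1 and NE2/3/4.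

THE POINT (owner census `t4/b2b-balaban-t4-ne7c-p1/ONECALL-CENSUS-NE7c.md` rows R06∕R07∕R09∕R10p∕R22, the e-copies).  Every END
host of record since S80 f3 (`…AssembledDecay`, `…ReachBox`, S99 f3b `…Cf`, S104 f2∕f4 `…CfLin(CoTests)`) displays the GLOBAL
scheme step TWICE: (T2) for the Wilson leg as KERNELS `k𝒢 kι kH kH₁` on flat pi-types with decay rows
`‖k· V c b′‖ ≤ c·e^{−δ·dis(pos c, pos b′)}`, reduced-rate sums `Σ_{b′} e^{−(δ· − δw)·dis(x, pos b′)} ≤ M·` and ONE one-sided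
Lipschitz pin `ϖw x ≤ ϖw y + dis x y` — read internally in S69's pinned spaces at pin rate `δw` (S80 f2 ∕ S74 f4 over S81) —,
and (T3) for the non-Wilson leg as ABSTRACT continuous linear maps between pinned spaces `𝒢e V : 𝒵e →L WSup (pinW δ′ ϖ) 1 𝔄`,
`H₁e`, `ιe`, `He` with a (P4) letter `W𝒱e` and a datum `Te`, each with its own norm row and letters.  By B14 (2.18) ONE term of
the k-th action has ONE exponent field read by the 𝓔-terms and by the Wilson plaquettes alike; this file supplies the three
shapes that let the non-Wilson SUPPLIER (S71 f2) be fired with (T2)'s kernels in the pinned dress (file 2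
`ShellMeasureRayTermsPinnedLandauW`; the v6 ROOT S112 f3 = S80 f3′ consumes it, R-ne7cp1-g37-1 (c2)):
* §1 **`norm_kerOpPin_le_of_decay_junction(_family)`** — S69 (A) `opNorm_kerOpPin_le` in BINDER FORM: decay kernel at rate
  `δ`, one-sided Lipschitz pin, reduced-rate sums at rate `δ − δ′`, and ONE number junction `c₀·M ≤ B` ⟹
  `∀ V f, ‖kerOpPin (k V) δ′ (ϖ∘posIn) (ϖ∘posOut) f‖ ≤ B·‖f‖` — LITERALLY the shape of the hosts' `h𝒢e`∕`hH₁e`∕`hHe` once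
  `𝒢e V := kerOpPin (k𝒢 V) …` (NO `0 ≤ dis` needed: the conjugation produces the reduced rate by itself).
* §2 **`pinned_quad_le_of_local`, `prop4Hyp_pinned_of_local`** — NEW SHAPE (S75 `prop4Hyp_pinned` wants a located quadratic
  MAJORANT, S81 f1∕f2 give pinned-LIPSCHITZ): a flat nonlinear letter `W : (Λ → 𝔄) → (Λz → ℭ)` with B11 Prop. 4's FLAT pair
  `Prop4Hyp W C₄ a₃`, located supports `N` (`hloc`) and reach `N c b → ϖz c − r ≤ ϖ b`, pins `δ′ ≥ 0`, `ϖ ≥ 0` ⟹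
  `Prop4Hyp (toPiLz.symm ∘ W ∘ toPiL) (C₄·e^{δ′r}) a₃` LITERALLY between the pinned spaces.  Per output component `c`:
  `W A c = W (trunc_{N c} A) c` (locality), `‖W (trunc A)‖ ≤ C₄‖trunc A‖² ≤ C₄‖trunc A‖·‖A‖`, S69 `norm_trunc_le`
  (`‖trunc A‖ ≤ e^{−δ′(ϖz c − r)}‖Y‖_pin`) and `norm_toPiL_le_of_nonneg` (`‖A‖ ≤ ‖Y‖_pin`) — ONE factor `e^{δ′r}`, no sign
  on `ϖz`; the analytic clause transfers through S65 f2a `WSup.differentiableOn_iff` (the pinned ball lies in the flat ball).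
* §3 **`norm_pinRead_comp_le`, `opNorm_pinRead_comp_le`, `pinRead_comp_mul_lt`** — a datum `T : E →L (Λb → 𝔇)` whose values
  vanish off the block `{0 < ϖb}` has the SAME operator norm read through the pin (S75 §1 `norm_ofPin_le_of_support`), so the
  hosts' number row `‖Te V‖·rΦe < be` follows from `‖Tw V‖·rΦw < bw` once `Te V := toPiLb.symm ∘L Tw V`.
* §4 NON-VACUITY: §2 on the zero letter; **`eNumberRows_inhabited`** — for ANY positive values of the letters that survive in
  the e-leg's number rows after the instantiation (`B₀w`, `C₄w·e^{δw rW}`, `a₃w`, `9·C2cov·e^{2δw rC}`, `landauRad`,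
  `4·C2cov·e^{2δw rC}`, `rE`) there are `ε₄e ≥ 0`, `bw > 0` satisfying `hdome hselfe hcontre hqe hRCe hcoupE` JOINTLY (rule G-1's
  number half; the operator half rides with the S96∕S106 toys whose kernels vanish).
DISPLAYED, NOT DISCHARGED (c2): the decay kernels of `𝒢`, `ι`, `H`, `H₁` ([Balaban1985BackgroundPropagators] (3.133)∕Thm 3.3,
[Balaban1985Variational] (46)∕(103) TYPE — W-a∕W-h, LOCATORS for the SHAPE only), the flat (P4) pair (Prop. 4 (97)–(98) TYPE);
nothing of Bałaban's at a live level is discharged; NOTHING in the countdown moves; NE7c NOT PROVED; spine PROVED 0∕9.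
-/

noncomputable section

open Set Metric Function

namespace Summit.QuantumFields.BalabanUV.T4Continuum.ShellMeasurePinnedDressOneTuple

open Literature.MathematicalPhysics.QuantumFieldTheory.Balaban1983to89
open B11Prop6Scheme (Prop4Hyp)
open Summit.QuantumFields.BalabanUV.T4Continuum.ShellMeasureMultiGridNorms (WSup)
open Summit.QuantumFields.BalabanUV.T4Continuum.ShellMeasureMultiGridNorms.WSup (toPiL toPiL_apply toPiL_symm_apply
  norm_le_iff)
open Summit.QuantumFields.BalabanUV.T4Continuum.ShellMeasureDecayKernelSums (kerOp)
open Summit.QuantumFields.BalabanUV.T4Continuum.ShellMeasurePinnedNorm (pinW pinW_apply kerOpPin opNorm_kerOpPin_le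
  norm_trunc_le norm_toPiL_le_of_nonneg)
open Summit.QuantumFields.BalabanUV.T4Continuum.ShellMeasurePinnedProp4 (norm_ofPin_le_of_support)

/-! ## §1 Linear letters: S69 (A) in binder form -/

section Linear

variable {Λ Λ' : Type*} [Fintype Λ] [Fintype Λ'] {𝔄 𝔅 : Type*} [NormedAddCommGroup 𝔄] [NormedSpace ℂ 𝔄]
  [NormedAddCommGroup 𝔅] [NormedSpace ℂ 𝔅] {S : Type*}

/-- **A DECAYING KERNEL READ BETWEEN THE PINNED SPACES, BINDER FORM.**  Kernel `‖k c b‖ ≤ c₀e^{−δρ(posOut c, posIn b)}`,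
pin profile `ϖ` one-sided Lipschitz for `ρ`, `δ′ ≥ 0`, reduced-rate sums `Σ_b e^{−(δ−δ′)ρ(x, posIn b)} ≤ M`, and the number
junction `c₀·M ≤ B` ⟹ `‖kerOpPin k δ′ (ϖ∘posIn) (ϖ∘posOut) f‖ ≤ B·‖f‖` for every pinned field `f` (S69 (A) `opNorm_kerOpPin_le`
∘ `le_opNorm`). [folklore] -/
theorem norm_kerOpPin_le_of_decay_junction (k : Λ' → Λ → (𝔄 →L[ℂ] 𝔅)) (ρ : S → S → ℝ) (posIn : Λ → S)
    (posOut : Λ' → S) (ϖ : S → ℝ) {c₀ δ δ' M B : ℝ} (hc₀ : 0 ≤ c₀) (hδ' : 0 ≤ δ') (hM0 : 0 ≤ M)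
    (hk : ∀ c b, ‖k c b‖ ≤ c₀ * Real.exp (-(δ * ρ (posOut c) (posIn b))))
    (hϖ : ∀ x y, ϖ x ≤ ϖ y + ρ x y)
    (hM : ∀ x : S, ∑ b, Real.exp (-((δ - δ') * ρ x (posIn b))) ≤ M) (hB : c₀ * M ≤ B)
    (f : WSup (pinW δ' (ϖ ∘ posIn)) 1 𝔄) :
    ‖kerOpPin k δ' (ϖ ∘ posIn) (ϖ ∘ posOut) f‖ ≤ B * ‖f‖ :=
  ((kerOpPin k δ' (ϖ ∘ posIn) (ϖ ∘ posOut)).le_opNorm f).trans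
    (mul_le_mul_of_nonneg_right
      ((opNorm_kerOpPin_le k ρ posIn posOut ϖ hc₀ hδ' hM0 hk hϖ hM).trans hB) (norm_nonneg _))

/-- **… FOR A FAMILY OF KERNELS INDEXED BY THE EXTERIOR SECTION** (decay row uniform in `V`): LITERALLY the shape
`∀ V f, ‖𝒢e V f‖ ≤ B·‖f‖` of the hosts' `h𝒢e` ∕ `hH₁e` ∕ `hHe` once `𝒢e V := kerOpPin (k V) δ′ (ϖ∘posIn) (ϖ∘posOut)`.
[folklore] -/
theorem norm_kerOpPin_le_of_decay_junction_family {𝒱 : Type*} (k : 𝒱 → Λ' → Λ → (𝔄 →L[ℂ] 𝔅)) (ρ : S → S → ℝ)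
    (posIn : Λ → S) (posOut : Λ' → S) (ϖ : S → ℝ) {c₀ δ δ' M B : ℝ} (hc₀ : 0 ≤ c₀) (hδ' : 0 ≤ δ') (hM0 : 0 ≤ M)
    (hk : ∀ V c b, ‖k V c b‖ ≤ c₀ * Real.exp (-(δ * ρ (posOut c) (posIn b))))
    (hϖ : ∀ x y, ϖ x ≤ ϖ y + ρ x y)
    (hM : ∀ x : S, ∑ b, Real.exp (-((δ - δ') * ρ x (posIn b))) ≤ M) (hB : c₀ * M ≤ B) :
    ∀ (V : 𝒱) (f : WSup (pinW δ' (ϖ ∘ posIn)) 1 𝔄), ‖kerOpPin (k V) δ' (ϖ ∘ posIn) (ϖ ∘ posOut) f‖ ≤ B * ‖f‖ :=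
  fun V f => norm_kerOpPin_le_of_decay_junction (k V) ρ posIn posOut ϖ hc₀ hδ' hM0 (hk V) hϖ hM hB f

/-- The unit-norm variant (no junction number): `c₀·M ≤ 1 ⟹ ‖kerOpPin (k V) … f‖ ≤ ‖f‖` — the shape of `hιe`; recorded for
completeness, NOT used by file 2 (for a restriction-type letter `cι·Mι ≤ 1` is no faithful stand-in, S108's remark).
[folklore] -/
theorem norm_kerOpPin_le_of_decay_junction_one {𝒱 : Type*} (k : 𝒱 → Λ' → Λ → (𝔄 →L[ℂ] 𝔅)) (ρ : S → S → ℝ)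
    (posIn : Λ → S) (posOut : Λ' → S) (ϖ : S → ℝ) {c₀ δ δ' M : ℝ} (hc₀ : 0 ≤ c₀) (hδ' : 0 ≤ δ') (hM0 : 0 ≤ M)
    (hk : ∀ V c b, ‖k V c b‖ ≤ c₀ * Real.exp (-(δ * ρ (posOut c) (posIn b))))
    (hϖ : ∀ x y, ϖ x ≤ ϖ y + ρ x y)
    (hM : ∀ x : S, ∑ b, Real.exp (-((δ - δ') * ρ x (posIn b))) ≤ M) (h1 : c₀ * M ≤ 1) :
    ∀ (V : 𝒱) (f : WSup (pinW δ' (ϖ ∘ posIn)) 1 𝔄), ‖kerOpPin (k V) δ' (ϖ ∘ posIn) (ϖ ∘ posOut) f‖ ≤ ‖f‖ :=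
  fun V f => (norm_kerOpPin_le_of_decay_junction (k V) ρ posIn posOut ϖ hc₀ hδ' hM0 (hk V) hϖ hM h1 f).trans_eq
    (one_mul _)

end Linear

/-! ## §2 The (P4) letter between the pinned spaces, by locality from the flat pair -/

section P4

variable {Λ Λz : Type*} [Fintype Λ] [Fintype Λz] {𝔄 ℭ : Type*} [NormedAddCommGroup 𝔄] [NormedSpace ℂ 𝔄]
  [NormedAddCommGroup ℭ] [NormedSpace ℂ ℭ]

/-- **THE PINNED QUADRATIC BOUND BY LOCALITY.**  `W : (Λ → 𝔄) → (Λz → ℭ)` with located supports `N c` (`hloc`), reach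
`N c b → ϖz c − r ≤ ϖ b`, pins `δ′ ≥ 0`, `ϖ ≥ 0`, and the FLAT quadratic bound `‖W A‖ ≤ C₄‖A‖²` on `‖A‖ < a₃` (`0 ≤ C₄`) ⟹ for
every pinned field `‖Y‖_pin < a₃`: `‖toPiLz.symm (W (toPiL Y))‖_pin ≤ C₄·e^{δ′r}·‖Y‖_pin²`. [folklore] -/
theorem pinned_quad_le_of_local {δ' : ℝ} (hδ' : 0 ≤ δ') (ϖ : Λ → ℝ) (hϖ0 : ∀ b, 0 ≤ ϖ b) (ϖz : Λz → ℝ)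
    {W : (Λ → 𝔄) → (Λz → ℭ)} (N : Λz → Λ → Prop)
    (hloc : ∀ A A' : Λ → 𝔄, ∀ c, (∀ b, N c b → A b = A' b) → W A c = W A' c)
    {r : ℝ} (hreach : ∀ c b, N c b → ϖz c - r ≤ ϖ b) {C₄ a₃ : ℝ} (hC₄ : 0 ≤ C₄)
    (hquad : ∀ A : Λ → 𝔄, ‖A‖ < a₃ → ‖W A‖ ≤ C₄ * ‖A‖ ^ 2)
    (Y : WSup (pinW δ' ϖ) 1 𝔄) (hY : ‖Y‖ < a₃) :
    ‖((toPiL (pinW δ' ϖz) 1).symm (W (toPiL (pinW δ' ϖ) 1 Y)) : WSup (pinW δ' ϖz) 1 ℭ)‖ ≤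
      C₄ * Real.exp (δ' * r) * ‖Y‖ ^ 2 := by
  classical
  set A : Λ → 𝔄 := toPiL (pinW δ' ϖ) 1 Y with hA
  have hflat : ‖A‖ ≤ ‖Y‖ := norm_toPiL_le_of_nonneg hδ' hϖ0 Y
  have hY0 : 0 ≤ ‖Y‖ := norm_nonneg _
  refine (norm_le_iff (pinW δ' ϖz) 1 (by positivity)).2 fun c => ?_
  rw [pow_one, pinW_apply]
  have hcomp : ((toPiL (pinW δ' ϖz) 1).symm (W A) : WSup (pinW δ' ϖz) 1 ℭ) c = W A c := rfl
  rw [hcomp]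
  -- the truncation of `A` to the located support of `c`
  set s : Finset Λ := Finset.univ.filter (N c) with hs
  set T : Λ → 𝔄 := fun b => if b ∈ s then A b else 0 with hT
  have hWT : W A c = W T c := hloc A T c fun b hb => by
    have hbs : b ∈ s := by rw [hs, Finset.mem_filter]; exact ⟨Finset.mem_univ b, hb⟩
    rw [hT]; dsimp only; rw [if_pos hbs]
  have hTA : ‖T‖ ≤ ‖A‖ := by
    refine (pi_norm_le_iff_of_nonneg (norm_nonneg A)).2 fun b => ?_
    by_cases hb : b ∈ s
    · rw [hT]; dsimp only; rw [if_pos hb]; exact norm_le_pi_norm A b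
    · rw [hT]; dsimp only; rw [if_neg hb, norm_zero]; exact norm_nonneg A
  have hTa : ‖T‖ < a₃ := (hTA.trans hflat).trans_lt hY
  have htrunc : ‖T‖ ≤ Real.exp (-(δ' * (ϖz c - r))) * ‖Y‖ := by
    have h := norm_trunc_le (𝔄 := 𝔄) s hδ' ϖ
      (fun b hb => hreach c b (by rw [hs, Finset.mem_filter] at hb; exact hb.2)) Y
    have e : (fun b => if b ∈ s then Y b else (0 : 𝔄)) = T := by
      funext b; rw [hT]; dsimp only; rfl
    rw [e] at h
    exact h
  have h1 : ‖W A c‖ ≤ C₄ * (Real.exp (-(δ' * (ϖz c - r))) * ‖Y‖) * ‖Y‖ := by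
    rw [hWT]
    calc ‖W T c‖ ≤ ‖W T‖ := norm_le_pi_norm _ c
      _ ≤ C₄ * ‖T‖ ^ 2 := hquad T hTa
      _ = C₄ * ‖T‖ * ‖T‖ := by ring
      _ ≤ C₄ * (Real.exp (-(δ' * (ϖz c - r))) * ‖Y‖) * ‖Y‖ :=
          mul_le_mul (mul_le_mul_of_nonneg_left htrunc hC₄) (hTA.trans hflat) (norm_nonneg _) (by positivity)
  have hexp : Real.exp (δ' * ϖz c) * Real.exp (-(δ' * (ϖz c - r))) = Real.exp (δ' * r) := by
    rw [← Real.exp_add]; congr 1; ring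
  calc Real.exp (δ' * ϖz c) * ‖W A c‖
      ≤ Real.exp (δ' * ϖz c) * (C₄ * (Real.exp (-(δ' * (ϖz c - r))) * ‖Y‖) * ‖Y‖) :=
        mul_le_mul_of_nonneg_left h1 (Real.exp_nonneg _)
    _ = C₄ * (Real.exp (δ' * ϖz c) * Real.exp (-(δ' * (ϖz c - r)))) * ‖Y‖ ^ 2 := by ring
    _ = C₄ * Real.exp (δ' * r) * ‖Y‖ ^ 2 := by rw [hexp]

/-- **THE (P4) LETTER BETWEEN THE PINNED SPACES, BY LOCALITY — `hWe` FROM `hWw` + `hlocW` + `hreachW`.**  Under the hypotheses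
of `pinned_quad_le_of_local` with the full flat pair `Prop4Hyp W C₄ a₃` (`0 < a₃`):
`Prop4Hyp (toPiLz.symm ∘ W ∘ toPiL) (C₄·e^{δ′r}) a₃` LITERALLY — the pinned ball lies in the flat ball (`e^{δ′ϖ} ≥ 1`), so
differentiability transfers through S65 f2a `WSup.differentiableOn_iff`. [folklore] -/
theorem prop4Hyp_pinned_of_local {δ' : ℝ} (hδ' : 0 ≤ δ') (ϖ : Λ → ℝ) (hϖ0 : ∀ b, 0 ≤ ϖ b) (ϖz : Λz → ℝ)
    {W : (Λ → 𝔄) → (Λz → ℭ)} (N : Λz → Λ → Prop)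
    (hloc : ∀ A A' : Λ → 𝔄, ∀ c, (∀ b, N c b → A b = A' b) → W A c = W A' c)
    {r : ℝ} (hreach : ∀ c b, N c b → ϖz c - r ≤ ϖ b) {C₄ a₃ : ℝ} (hC₄ : 0 ≤ C₄) (ha₃ : 0 < a₃)
    (hW : Prop4Hyp W C₄ a₃) :
    Prop4Hyp (fun Y : WSup (pinW δ' ϖ) 1 𝔄 =>
        ((toPiL (pinW δ' ϖz) 1).symm (W (toPiL (pinW δ' ϖ) 1 Y)) : WSup (pinW δ' ϖz) 1 ℭ))
      (C₄ * Real.exp (δ' * r)) a₃ where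
  quad Y hY := pinned_quad_le_of_local hδ' ϖ hϖ0 ϖz N hloc hreach hC₄ hW.quad Y hY
  differentiableOn := by
    rw [WSup.differentiableOn_iff (pinW δ' ϖ) 1 (pinW δ' ϖz) 1 W ha₃]
    refine hW.differentiableOn.mono fun A hA => ?_
    simp only [mem_setOf_eq] at hA ⊢
    refine (pi_norm_lt_iff ha₃).2 fun b => ?_
    have hb := hA b
    rw [pow_one, pinW_apply] at hb
    have h1 : (1 : ℝ) ≤ Real.exp (δ' * ϖ b) := Real.one_le_exp (mul_nonneg hδ' (hϖ0 b))
    calc ‖A b‖ = 1 * ‖A b‖ := (one_mul _).symm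
      _ ≤ Real.exp (δ' * ϖ b) * ‖A b‖ := mul_le_mul_of_nonneg_right h1 (norm_nonneg _)
      _ < a₃ := hb

/-- **… FOR A FAMILY INDEXED BY THE EXTERIOR SECTION** (`hlocW` uniform in `V`): LITERALLY the hosts' `hWe` once
`W𝒱e V := toPiLz.symm ∘ W𝒱w V ∘ toPiL`, `C₄e := C₄w·e^{δw·rW}`, `a₃e := a₃w`. [folklore] -/
theorem prop4Hyp_pinned_of_local_family {𝒱 : Type*} {δ' : ℝ} (hδ' : 0 ≤ δ') (ϖ : Λ → ℝ) (hϖ0 : ∀ b, 0 ≤ ϖ b)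
    (ϖz : Λz → ℝ) (W : 𝒱 → (Λ → 𝔄) → (Λz → ℭ)) (N : Λz → Λ → Prop)
    (hloc : ∀ V, ∀ A A' : Λ → 𝔄, ∀ c, (∀ b, N c b → A b = A' b) → W V A c = W V A' c)
    {r : ℝ} (hreach : ∀ c b, N c b → ϖz c - r ≤ ϖ b) {C₄ a₃ : ℝ} (hC₄ : 0 ≤ C₄) (ha₃ : 0 < a₃)
    (hW : ∀ V, Prop4Hyp (W V) C₄ a₃) :
    ∀ V, Prop4Hyp (fun Y : WSup (pinW δ' ϖ) 1 𝔄 =>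
        ((toPiL (pinW δ' ϖz) 1).symm (W V (toPiL (pinW δ' ϖ) 1 Y)) : WSup (pinW δ' ϖz) 1 ℭ))
      (C₄ * Real.exp (δ' * r)) a₃ :=
  fun V => prop4Hyp_pinned_of_local hδ' ϖ hϖ0 ϖz N (hloc V) hreach hC₄ ha₃ (hW V)

end P4

/-! ## §3 The coarse datum read through the pin -/

section Datum

variable {Λb : Type*} [Fintype Λb] {𝔇 : Type*} [NormedAddCommGroup 𝔇] [NormedSpace ℂ 𝔇] {E : Type*}
  [NormedAddCommGroup E] [NormedSpace ℂ E]

/-- **A BLOCK-SUPPORTED DATUM HAS THE SAME SIZE THROUGH THE PIN**: `T : E →L (Λb → 𝔇)` with `T z i = 0` whenever `0 < ϖb i`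
(`δ′ ≥ 0`) ⟹ `‖toPiLb.symm (T z)‖_pin ≤ ‖T‖·‖z‖` (S75 §1 `norm_ofPin_le_of_support`). [folklore] -/
theorem norm_pinRead_comp_le {δ' : ℝ} (hδ' : 0 ≤ δ') (ϖb : Λb → ℝ) (T : E →L[ℂ] (Λb → 𝔇))
    (hsupp : ∀ z i, 0 < ϖb i → T z i = 0) (z : E) :
    ‖((toPiL (pinW δ' ϖb) 1).symm.toContinuousLinearMap.comp T) z‖ ≤ ‖T‖ * ‖z‖ := by
  rw [ContinuousLinearMap.comp_apply, ContinuousLinearEquiv.coe_coe]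
  exact (norm_ofPin_le_of_support hδ' ϖb (T z) (hsupp z)).trans (T.le_opNorm z)

/-- … hence `‖toPiLb.symm ∘L T‖ ≤ ‖T‖`. [folklore] -/
theorem opNorm_pinRead_comp_le {δ' : ℝ} (hδ' : 0 ≤ δ') (ϖb : Λb → ℝ) (T : E →L[ℂ] (Λb → 𝔇))
    (hsupp : ∀ z i, 0 < ϖb i → T z i = 0) :
    ‖(toPiL (pinW δ' ϖb) 1).symm.toContinuousLinearMap.comp T‖ ≤ ‖T‖ :=
  ContinuousLinearMap.opNorm_le_bound _ (norm_nonneg _) (norm_pinRead_comp_le hδ' ϖb T hsupp)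

/-- **THE NUMBER ROW TRANSFERS**: `‖T‖·ρ < b`, `0 ≤ ρ` ⟹ `‖toPiLb.symm ∘L T‖·ρ < b` — the hosts' `hTbe` from `hTbw` once
`Te V := toPiLb.symm ∘L Tw V`, `rΦe := rΦw`, `be := bw` (family form, `hsupp` uniform in `V`). [folklore] -/
theorem pinRead_comp_mul_lt_family {𝒱 : Type*} {δ' : ℝ} (hδ' : 0 ≤ δ') (ϖb : Λb → ℝ) (T : 𝒱 → (E →L[ℂ] (Λb → 𝔇)))
    (hsupp : ∀ V z i, 0 < ϖb i → T V z i = 0) {ρ b : ℝ} (hρ : 0 ≤ ρ) (hTb : ∀ V, ‖T V‖ * ρ < b) :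
    ∀ V, ‖(toPiL (pinW δ' ϖb) 1).symm.toContinuousLinearMap.comp (T V)‖ * ρ < b :=
  fun V => (mul_le_mul_of_nonneg_right (opNorm_pinRead_comp_le hδ' ϖb (T V) (hsupp V)) hρ).trans_lt (hTb V)

end Datum

/-! ## §4 Non-vacuity -/

section NonVacuity

/-- NON-VACUITY of §2 (trigger c3): the binder shapes of `prop4Hyp_pinned_of_local` are jointly inhabited by the ZERO letter
on one-point index sets (empty supports, reach `0`, `C₄ = 0`, `a₃ = 1`, pins `≡ 0`). [folklore] -/
example : Prop4Hyp (fun Y : WSup (pinW (0 : ℝ) (fun _ : Unit => (0 : ℝ))) 1 ℂ =>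
    ((toPiL (pinW (0 : ℝ) (fun _ : Unit => (0 : ℝ))) 1).symm
      ((fun _ : Unit → ℂ => (0 : Unit → ℂ)) (toPiL (pinW (0 : ℝ) (fun _ : Unit => (0 : ℝ))) 1 Y)) :
        WSup (pinW (0 : ℝ) (fun _ : Unit => (0 : ℝ))) 1 ℂ)) (0 * Real.exp (0 * 0)) 1 :=
  prop4Hyp_pinned_of_local (W := fun _ : Unit → ℂ => (0 : Unit → ℂ)) le_rfl (fun _ => 0) (fun _ => le_rfl)
    (fun _ => 0) (fun _ _ => False) (fun _ _ _ _ => rfl) (fun _ _ h => h.elim) le_rfl one_pos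
    ⟨fun Y _ => by simp, differentiableOn_const _⟩

/-- **THE e-LEG's SURVIVING NUMBER ROWS ARE JOINTLY INHABITED WITH THE w-LETTERS** (rule G-1, number half).  For ANY `B₀ > 0`
(the hosts' `B₀w`), `C ≥ 0` (`C₄w·e^{δw rW}`), `a > 0` (`a₃w`), `Q ≥ 0` (`9·C2cov·e^{2δw rC}`), `R > 0` (`landauRad`), `Q′ ≥ 0`
(`4·C2cov·e^{2δw rC}`), `rE > 0` there are `ε₄e ≥ 0` and `bw > 0` with, for `X := ε₄e + B₀·bw`: `2X ≤ a` (hdome),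
`B₀·C·X² ≤ ε₄e` (hselfe), `4·B₀·C·X < 1` (hcontre), `Q·B₀·X < 1` (hqe), `3X ≤ R` (hRCe), `X + B₀·(Q′·X²) ≤ rE∕2` (hcoupE).
Witness: `X := 1∕K`, `K := 2∕a + 3∕R + 4∕rE + 8B₀C + 2QB₀ + B₀Q′ + 1`, `ε₄e := X∕2`, `bw := X∕(2B₀)`. [folklore] -/
theorem eNumberRows_inhabited {B₀ C a Q R Q' rE : ℝ} (hB₀ : 0 < B₀) (hC : 0 ≤ C) (ha : 0 < a) (hQ : 0 ≤ Q) (hR : 0 < R)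
    (hQ' : 0 ≤ Q') (hrE : 0 < rE) :
    ∃ ε₄e bw : ℝ, 0 ≤ ε₄e ∧ 0 < bw ∧
      2 * (ε₄e + B₀ * bw) ≤ a ∧
      B₀ * C * (ε₄e + B₀ * bw) ^ 2 ≤ ε₄e ∧
      4 * B₀ * C * (ε₄e + B₀ * bw) < 1 ∧
      Q * B₀ * (ε₄e + B₀ * bw) < 1 ∧
      3 * (ε₄e + B₀ * bw) ≤ R ∧
      (ε₄e + B₀ * bw) + B₀ * (Q' * (ε₄e + B₀ * bw) ^ 2) ≤ rE / 2 := by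
  -- the budget `K` dominates every single demand; `X := 1∕K`
  set K : ℝ := 2 / a + 3 / R + 4 / rE + 8 * B₀ * C + 2 * Q * B₀ + B₀ * Q' + 1 with hK
  have h2a : 0 < 2 / a := by positivity
  have h3R : 0 < 3 / R := by positivity
  have h4r : 0 < 4 / rE := by positivity
  have hBC : 0 ≤ 8 * B₀ * C := by positivity
  have hQB : 0 ≤ 2 * Q * B₀ := by positivity
  have hBQ : 0 ≤ B₀ * Q' := by positivity
  have hKa : 2 / a ≤ K := by rw [hK]; linarith
  have hKR : 3 / R ≤ K := by rw [hK]; linarith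
  have hKr : 4 / rE ≤ K := by rw [hK]; linarith
  have hKC : 8 * B₀ * C ≤ K - 1 := by rw [hK]; linarith
  have hKQ : 2 * Q * B₀ ≤ K - 1 := by rw [hK]; linarith
  have hKQ' : B₀ * Q' ≤ K - 1 := by rw [hK]; linarith
  have hK0 : 0 < K := by linarith
  set X : ℝ := 1 / K with hX
  have hX0 : 0 < X := by rw [hX]; positivity
  have hXK : X * K = 1 := by rw [hX]; field_simp
  -- `X ≤ 1∕t` for every demand `t ≤ K`
  have hXle : ∀ t : ℝ, 0 < t → t ≤ K → X * t ≤ 1 := fun t ht htK => by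
    calc X * t ≤ X * K := mul_le_mul_of_nonneg_left htK hX0.le
      _ = 1 := hXK
  have hXa : 2 * X ≤ a := by
    have h := hXle (2 / a) h2a hKa
    rw [mul_div_assoc', div_le_one ha] at h
    linarith
  have hXR : 3 * X ≤ R := by
    have h := hXle (3 / R) h3R hKR
    rw [mul_div_assoc', div_le_one hR] at h
    linarith
  have hXr : 4 * X ≤ rE := by
    have h := hXle (4 / rE) h4r hKr
    rw [mul_div_assoc', div_le_one hrE] at h
    linarith
  -- the products against `K − 1 < K`: strict
  have hXlt : ∀ t : ℝ, 0 ≤ t → t ≤ K - 1 → X * t < 1 := fun t ht htK => by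
    calc X * t ≤ X * (K - 1) := mul_le_mul_of_nonneg_left htK hX0.le
      _ = 1 - X := by rw [mul_sub, hXK, mul_one]
      _ < 1 := by linarith
  have hXC : 8 * B₀ * C * X < 1 := by have h := hXlt _ hBC hKC; linarith [mul_comm X (8 * B₀ * C)]
  have hXQ : 2 * Q * B₀ * X < 1 := by have h := hXlt _ hQB hKQ; linarith [mul_comm X (2 * Q * B₀)]
  have hXQ' : B₀ * Q' * X < 1 := by have h := hXlt _ hBQ hKQ'; linarith [mul_comm X (B₀ * Q')]
  have hsum : X / 2 + B₀ * (X / (2 * B₀)) = X := by field_simp; ring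
  refine ⟨X / 2, X / (2 * B₀), by positivity, by positivity, ?_, ?_, ?_, ?_, ?_, ?_⟩ <;> rw [hsum]
  · exact hXa
  · -- `B₀CX² ≤ X∕2` ⟸ `8B₀C·X < 1`
    have hBCX : 0 ≤ B₀ * C * X := by positivity
    nlinarith
  · nlinarith [mul_nonneg (mul_nonneg hB₀.le hC) hX0.le]
  · nlinarith [mul_nonneg (mul_nonneg hQ hB₀.le) hX0.le]
  · exact hXR
  · -- `X + B₀Q′X² ≤ rE∕2` ⟸ `4X ≤ rE` and `B₀Q′X < 1`
    have hq : B₀ * (Q' * X ^ 2) ≤ X := by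
      have : B₀ * (Q' * X ^ 2) = (B₀ * Q' * X) * X := by ring
      rw [this]
      exact (mul_le_of_le_one_left hX0.le hXQ'.le)
    linarith

end NonVacuity

end Summit.QuantumFields.BalabanUV.T4Continuum.ShellMeasurePinnedDressOneTuple

end
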